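import Summits.CriticalPhenomena.PercolationContinuityZ3.Theorems.PercNearOneGluingNoHeavyLowerTailKnQuestion8CoefficientwisePEOCCex
import Mathlib.Data.Fin.VecNotation
import HarnessLib

/-!
# The atom conjecture (I2) `A₀B ≥ 0` of the NC-SPLIT (prim-lf-2 gens 60–61) is FALSE — a kernel-checked 8-vertex witness (prim-lf-2 gen 68)

Support file (`--supports stmt-CriticalPhenomena-4575`, closed), prover `prim-lf-2` (gen 68).  No named facts, no sorries; standard axioms; the arithmetic is
`decide +kernel` on the two-colour edge recursion `IGCex.cwRec` of `…CoefficientwiseInGadgetCex.lean` (`2¹¹` leaves).  Memo `prim-lf-2/CW-SUBROWS-gen68.md` §2.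

Setting: uniform two-colourings `s` (red edge set) of a finite multigraph, `K s` the red cluster of the root `0`, `K(E∖s)` the blue one,
`T = (f(K s) − f(K(E∖s)))(g(K s) − g(K(E∖s)))` for monotone `f, g`.  Classifying a vertex `y` as `00` (`y` in neither cluster), `0B` (`y ∈ K(E∖s) ∖ K s`),
`K0`, `KB`, the single-target NO-CORE sum splits as `NO-CORE(y) = A₀₀ + 2·A₀B` (prim-lf-2 gen 60, 'NC-SPLIT'), and CONJECTURE (I2) (memos CW-ATOM-gen60 §9,
CW-FIBRE-gen61; exact-clean on all graphs with ≤ 7 vertices) asserted `A₀B := Σ_{s : y ∈ K(E∖s) ∖ K s} T ≥ 0` for all monotone `f, g`.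
IT FAILS on 8 vertices: `G` with edges `02 03 04 05 06 12 14 15 16 17 23` (root `0`; a `K_{2,4}` core `{0,1} × {2,4,5,6}`, the vertex `3 ∼ 0, 2`, and `y = 7` pendant at `1`),
`f = pt 3`, `g = pt 4 · pt 5 · pt 6` (the indicator of `{4,5,6} ⊆ ·`): the restricted sum is `−5` (found by prim-lf-2 gen 68's exact census kit j306233: 5 failures among the
442 890 triples (G, a, y) on 8 vertices with ≤ 11 edges; 0 failures on ≤ 7 vertices).
* `Coefficientwise.A0BCex.a0b_sum_eq` — `Σ_{s ⊆ E : 7 ∈ K(E∖s), 7 ∉ K s} (pt 3 (K s) − pt 3 (K(E∖s)))·(ppp (K s) − ppp (K(E∖s))) = −5`;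
* `Coefficientwise.A0BCex.not_I2_point` — hence "for every vertex `y` and all monotone `f, g`, `Σ_{s : y ∈ K(E∖s) ∖ K s} T ≥ 0`" is false for this graph;
* `Coefficientwise.A0BCex.cc_sum_eq`, `Coefficientwise.A0BCex.not_concCross_general` — the equivalent LINEAR form: with the source point `a = 3` in the red cluster
  only and the target `y = 7` in exactly one cluster, `Σ (g(K s) − g(K(E∖s))) = −5` for `g = ppp`; so the 'CONC ≥ CROSS with a general monotone `g`' row
  (`Σ_{a ∈ K∖B, y ∈ K△B} (g K − g B) ≥ 0`, `B = K(E∖s)`; exact-clean on ≤ 7 vertices, 124 980 triples) is false as well.  The complementary `00`-row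
  `Σ_{a ∈ K∖B, y ∉ K∪B}(gK − gB)` is `+71` here and the full point row `Σ_{a∈K∖B, y ∉ K∩B}(gK − gB) = 66 ≥ 0` (NO-CORE / NC* themselves are not touched:
  0 failures among the same 442 890 triples).
[cite: KozmaNitzan2024, Questions 8–9 (§5.5 p. 36) (context: the Question-8 pocket covariance programme)]
-/

namespace Summit.CriticalPhenomena.PercolationContinuityZ3.Theorems

open Finset Literature.Probability.Percolation Literature.Computation.FiniteGraph

namespace Coefficientwise

namespace A0BCex

open IGCex PEOCCex

/-- Edge table of the witness (8 vertices, 11 edges). -/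
def EL₆ : Fin 11 → ℕ × ℕ := ![(0,2), (0,3), (0,4), (0,5), (0,6), (1,2), (1,4), (1,5), (1,6), (1,7), (2,3)]

/-- All entries of `EL₆` are vertices of `Fin 8`. -/
theorem hEL₆ : ∀ i, (EL₆ i).1 < 8 ∧ (EL₆ i).2 < 8 := by decide

/-- The 8-vertex graph of the witness. -/
def ends₆ : Fin 11 → Sym2 (Fin 8) := endsOf EL₆ hEL₆

/-- All eleven edges as a list (for the recursion). -/
def lE₆ : List (Fin 11) := [0, 1, 2, 3, 4, 5, 6, 7, 8, 9, 10]

/-- The red cluster of the root `0` as a function of the red edge set. -/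
noncomputable def K₆ (s : Finset (Fin 11)) : Set (Fin 8) := openCluster (ends₆ '' (↑s : Set (Fin 11))) 0

/-- The monotone triple indicator `ppp A = pt 4 A · pt 5 A · pt 6 A = 1[{4,5,6} ⊆ A]`. -/
noncomputable def ppp (A : Set (Fin 8)) : ℝ := pt 4 A * pt 5 A * pt 6 A

/-- `ppp` is monotone. [folklore] -/
theorem ppp_monotone : Monotone ppp := fun A B hAB =>
  mul_le_mul (mul_le_mul (pt_monotone 4 hAB) (pt_monotone 5 hAB) (pt_nonneg 5 A) (pt_nonneg 4 B)) (pt_monotone 6 hAB) (pt_nonneg 6 A)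
    (mul_nonneg (pt_nonneg 4 B) (pt_nonneg 5 B))

/-- `ppp` evaluated through Boolean tests. [folklore] -/
theorem ppp_eq_of_iff {A : Set (Fin 8)} {p q r : Bool} (hp : (4 : Fin 8) ∈ A ↔ p = true) (hq : (5 : Fin 8) ∈ A ↔ q = true)
    (hr : (6 : Fin 8) ∈ A ↔ r = true) : ppp A = if (p && q && r) then 1 else 0 := by
  rw [ppp, pt_eq_of_iff hp, pt_eq_of_iff hq, pt_eq_of_iff hr]
  cases p <;> cases q <;> cases r <;> simp

/-- Integer leaf of the `A₀B` sum: `[7 ∈ blue cluster ∧ 7 ∉ red cluster]·(r₃ − b₃)(r₄r₅r₆ − b₄b₅b₆)`. -/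
def leaf₆ (lr lb : List ℕ) : ℤ :=
  leafB (jl lb 0 7 && !(jl lr 0 7)) (jl lr 0 3) (jl lb 0 3) (jl lr 0 4 && jl lr 0 5 && jl lr 0 6) (jl lb 0 4 && jl lb 0 5 && jl lb 0 6)

/-- Integer leaf of the linear CONC/CROSS row: `[3 ∈ red ∖ blue ∧ (7 ∈ red) ≠ (7 ∈ blue)]·(r₄r₅r₆ − b₄b₅b₆)`. -/
def leaf₇ (lr lb : List ℕ) : ℤ :=
  leafB (jl lr 0 3 && !(jl lb 0 3) && ((jl lr 0 7) != (jl lb 0 7))) true false (jl lr 0 4 && jl lr 0 5 && jl lr 0 6) (jl lb 0 4 && jl lb 0 5 && jl lb 0 6)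

/-- Kernel evaluation: the `A₀B` recursion of the witness is `−5`. -/
theorem cwRec₆ : cwRec leaf₆ (lE₆.map EL₆) (List.range 8) (List.range 8) = -5 := by
  decide +kernel

/-- Kernel evaluation: the CONC/CROSS recursion of the witness is `−5`. -/
theorem cwRec₇ : cwRec leaf₇ (lE₆.map EL₆) (List.range 8) (List.range 8) = -5 := by
  decide +kernel

open Classical in
/-- Real leaf of the `A₀B` sum as a function of the red and blue edge sets. -/
noncomputable def LEAF₆ (R B : Finset (Fin 11)) : ℝ :=
  (if ((7 : Fin 8) ∈ openCluster (ends₆ '' (↑B : Set (Fin 11))) 0 ∧ ¬ (7 : Fin 8) ∈ openCluster (ends₆ '' (↑R : Set (Fin 11))) 0) then (1 : ℝ) else 0) *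
    ((pt 3 (openCluster (ends₆ '' (↑R : Set (Fin 11))) 0) - pt 3 (openCluster (ends₆ '' (↑B : Set (Fin 11))) 0)) *
      (ppp (openCluster (ends₆ '' (↑R : Set (Fin 11))) 0) - ppp (openCluster (ends₆ '' (↑B : Set (Fin 11))) 0)))

open Classical in
/-- Real leaf of the CONC/CROSS row as a function of the red and blue edge sets. -/
noncomputable def LEAF₇ (R B : Finset (Fin 11)) : ℝ :=
  (if ((3 : Fin 8) ∈ openCluster (ends₆ '' (↑R : Set (Fin 11))) 0 ∧ ¬ (3 : Fin 8) ∈ openCluster (ends₆ '' (↑B : Set (Fin 11))) 0 ∧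
        ¬ ((7 : Fin 8) ∈ openCluster (ends₆ '' (↑R : Set (Fin 11))) 0 ↔ (7 : Fin 8) ∈ openCluster (ends₆ '' (↑B : Set (Fin 11))) 0)) then (1 : ℝ) else 0) *
    (((1 : ℝ) - 0) * (ppp (openCluster (ends₆ '' (↑R : Set (Fin 11))) 0) - ppp (openCluster (ends₆ '' (↑B : Set (Fin 11))) 0)))

/-- Boolean form of `A ∧ ¬B`. [folklore] -/
theorem bool_andNot {A B : Prop} {a b : Bool} (ha : A ↔ a = true) (hb : B ↔ b = true) : (A ∧ ¬ B) ↔ (a && !b) = true := by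
  cases a <;> cases b <;> simp_all

/-- Boolean form of `A ∧ ¬B ∧ ¬(C ↔ D)`. [folklore] -/
theorem bool_andNotXor {A B C D : Prop} {a b c d : Bool} (ha : A ↔ a = true) (hb : B ↔ b = true) (hc : C ↔ c = true) (hd : D ↔ d = true) :
    (A ∧ ¬ B ∧ ¬ (C ↔ D)) ↔ (a && !b && (c != d)) = true := by
  cases a <;> cases b <;> cases c <;> cases d <;> simp_all

open Classical in
/-- The integer leaf computes the real leaf of the `A₀B` sum. -/
theorem HL₆ : ∀ (R B : Finset (Fin 11)) (labR labB : List ℕ),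
    (∃ op : List (ℕ × ℕ), cfgOf 8 op = endsOf EL₆ hEL₆ '' (↑R : Set (Fin 11)) ∧ LabelsOK 8 op labR) →
    (∃ op : List (ℕ × ℕ), cfgOf 8 op = endsOf EL₆ hEL₆ '' (↑B : Set (Fin 11)) ∧ LabelsOK 8 op labB) →
    (leaf₆ labR labB : ℝ) = LEAF₆ R B := by
  intro R B labR labB hR hB
  rw [leaf₆, leafB_cast, LEAF₆, ends₆, ite_eq_of_iff (bool_andNot (mem_iff_of_inv hB 0 7) (mem_iff_of_inv hR 0 7)),
    pt_eq_of_iff (mem_iff_of_inv hR 0 3), pt_eq_of_iff (mem_iff_of_inv hB 0 3),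
    ppp_eq_of_iff (mem_iff_of_inv hR 0 4) (mem_iff_of_inv hR 0 5) (mem_iff_of_inv hR 0 6),
    ppp_eq_of_iff (mem_iff_of_inv hB 0 4) (mem_iff_of_inv hB 0 5) (mem_iff_of_inv hB 0 6)]
  rfl

open Classical in
/-- The integer leaf computes the real leaf of the CONC/CROSS row. -/
theorem HL₇ : ∀ (R B : Finset (Fin 11)) (labR labB : List ℕ),
    (∃ op : List (ℕ × ℕ), cfgOf 8 op = endsOf EL₆ hEL₆ '' (↑R : Set (Fin 11)) ∧ LabelsOK 8 op labR) →
    (∃ op : List (ℕ × ℕ), cfgOf 8 op = endsOf EL₆ hEL₆ '' (↑B : Set (Fin 11)) ∧ LabelsOK 8 op labB) →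
    (leaf₇ labR labB : ℝ) = LEAF₇ R B := by
  intro R B labR labB hR hB
  rw [leaf₇, leafB_cast, LEAF₇, ends₆,
    ite_eq_of_iff (bool_andNotXor (mem_iff_of_inv hR 0 3) (mem_iff_of_inv hB 0 3) (mem_iff_of_inv hR 0 7) (mem_iff_of_inv hB 0 7)),
    ppp_eq_of_iff (mem_iff_of_inv hR 0 4) (mem_iff_of_inv hR 0 5) (mem_iff_of_inv hR 0 6),
    ppp_eq_of_iff (mem_iff_of_inv hB 0 4) (mem_iff_of_inv hB 0 5) (mem_iff_of_inv hB 0 6)]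
  simp

open Classical in
/-- **The `A₀B` sum of the witness is `−5`**: over the colourings `s` with `7` in the BLUE cluster `K₆ (E ∖ s)` and not in the red cluster `K₆ s` (`E` = all eleven edges),
`Σ (pt 3 (K s) − pt 3 (K(E∖s)))·(ppp (K s) − ppp (K(E∖s))) = −5`. -/
theorem a0b_sum_eq :
    (∑ s ∈ (univ : Finset (Fin 11)).powerset.filter (fun s : Finset (Fin 11) => (7 : Fin 8) ∈ K₆ (univ \ s) ∧ (7 : Fin 8) ∉ K₆ s),
      (pt 3 (K₆ s) - pt 3 (K₆ (univ \ s))) * (ppp (K₆ s) - ppp (K₆ (univ \ s)))) = -5 := by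
  have hbridge := cwRec_eq_sum EL₆ hEL₆ leaf₆ LEAF₆ HL₆ lE₆ (by decide) ∅ ∅ _ _ (inv_empty EL₆ hEL₆) (inv_empty EL₆ hEL₆)
  have hl : lE₆.toFinset = (univ : Finset (Fin 11)) := by decide
  rw [hl, cwRec₆] at hbridge
  rw [Finset.sum_filter]
  have hsum : ∀ s ∈ (univ : Finset (Fin 11)).powerset,
      (if ((7 : Fin 8) ∈ K₆ (univ \ s) ∧ (7 : Fin 8) ∉ K₆ s) then (pt 3 (K₆ s) - pt 3 (K₆ (univ \ s))) * (ppp (K₆ s) - ppp (K₆ (univ \ s))) else 0) =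
        LEAF₆ (∅ ∪ s) (∅ ∪ (univ \ s)) := by
    intro s _
    by_cases hc : ((7 : Fin 8) ∈ K₆ (univ \ s) ∧ (7 : Fin 8) ∉ K₆ s)
    · rw [if_pos hc]
      simp only [K₆] at hc ⊢
      simp only [Finset.empty_union, LEAF₆, if_pos hc, one_mul]
    · rw [if_neg hc]
      simp only [K₆] at hc ⊢
      simp only [Finset.empty_union, LEAF₆, if_neg hc, zero_mul]
  rw [Finset.sum_congr rfl hsum, ← hbridge]
  norm_num

open Classical in
/-- **(I2) is false**: it is not the case that for every vertex `y` and all monotone `f, g` the two-colouring sum restricted to `{y ∈ K(E∖s) ∖ K s}`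
(the `0B`-class of `y`: in the blue cluster of the root, not in the red one) is nonnegative (witness: `y = 7`, `f = pt 3`, `g = ppp`, sum `−5`). -/
theorem not_I2_point :
    ¬ (∀ (y : Fin 8) (f g : Set (Fin 8) → ℝ), Monotone f → Monotone g →
      0 ≤ ∑ s ∈ (univ : Finset (Fin 11)).powerset.filter (fun s : Finset (Fin 11) => y ∈ K₆ (univ \ s) ∧ y ∉ K₆ s),
        (f (K₆ s) - f (K₆ (univ \ s))) * (g (K₆ s) - g (K₆ (univ \ s)))) := by
  intro h
  have h0 := h 7 (pt 3) ppp (pt_monotone 3) ppp_monotone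
  rw [a0b_sum_eq] at h0
  linarith

open Classical in
/-- **The CONC/CROSS row of the witness is `−5`**: over the colourings `s` with the source `3` in the red cluster only and the target `7` in exactly one of the two clusters,
`Σ (ppp (K s) − ppp (K(E∖s))) = −5`. -/
theorem cc_sum_eq :
    (∑ s ∈ (univ : Finset (Fin 11)).powerset.filter (fun s : Finset (Fin 11) =>
        (3 : Fin 8) ∈ K₆ s ∧ (3 : Fin 8) ∉ K₆ (univ \ s) ∧ ¬ ((7 : Fin 8) ∈ K₆ s ↔ (7 : Fin 8) ∈ K₆ (univ \ s))),
      (ppp (K₆ s) - ppp (K₆ (univ \ s)))) = -5 := by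
  have hbridge := cwRec_eq_sum EL₆ hEL₆ leaf₇ LEAF₇ HL₇ lE₆ (by decide) ∅ ∅ _ _ (inv_empty EL₆ hEL₆) (inv_empty EL₆ hEL₆)
  have hl : lE₆.toFinset = (univ : Finset (Fin 11)) := by decide
  rw [hl, cwRec₇] at hbridge
  rw [Finset.sum_filter]
  have hsum : ∀ s ∈ (univ : Finset (Fin 11)).powerset,
      (if ((3 : Fin 8) ∈ K₆ s ∧ (3 : Fin 8) ∉ K₆ (univ \ s) ∧ ¬ ((7 : Fin 8) ∈ K₆ s ↔ (7 : Fin 8) ∈ K₆ (univ \ s)))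
        then (ppp (K₆ s) - ppp (K₆ (univ \ s))) else 0) = LEAF₇ (∅ ∪ s) (∅ ∪ (univ \ s)) := by
    intro s _
    by_cases hc : ((3 : Fin 8) ∈ K₆ s ∧ (3 : Fin 8) ∉ K₆ (univ \ s) ∧ ¬ ((7 : Fin 8) ∈ K₆ s ↔ (7 : Fin 8) ∈ K₆ (univ \ s)))
    · rw [if_pos hc]
      simp only [K₆] at hc ⊢
      simp only [Finset.empty_union, LEAF₇, if_pos hc, one_mul, sub_zero]
    · rw [if_neg hc]
      simp only [K₆] at hc ⊢
      simp only [Finset.empty_union, LEAF₇, if_neg hc, zero_mul]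
  rw [Finset.sum_congr rfl hsum, ← hbridge]
  norm_num

open Classical in
/-- **CONC ≥ CROSS with a general monotone `g` is false**: it is not the case that for all vertices `a, y` and every monotone `g`,
`0 ≤ Σ_{s : a ∈ K s ∖ K(E∖s), y in exactly one of K s, K(E∖s)} (g(K s) − g(K(E∖s)))` (witness `a = 3`, `y = 7`, `g = ppp`, sum `−5`). -/
theorem not_concCross_general :
    ¬ (∀ (a y : Fin 8) (g : Set (Fin 8) → ℝ), Monotone g →
      0 ≤ ∑ s ∈ (univ : Finset (Fin 11)).powerset.filter (fun s : Finset (Fin 11) =>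
          a ∈ K₆ s ∧ a ∉ K₆ (univ \ s) ∧ ¬ (y ∈ K₆ s ↔ y ∈ K₆ (univ \ s))),
        (g (K₆ s) - g (K₆ (univ \ s)))) := by
  intro h
  have h0 := h 3 7 ppp ppp_monotone
  rw [cc_sum_eq] at h0
  linarith

end A0BCex

end Coefficientwise

end Summit.CriticalPhenomena.PercolationContinuityZ3.Theorems
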